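import Literature.Barriers.RiemannHypothesis.TuranPartialSumsBoxCertSound
import Literature.Barriers.RiemannHypothesis.TuranPartialSumsSpiraCertificates
import Literature.Barriers.RiemannHypothesis.TuranPartialSumsCertified
import HarnessLib

/-!
# Platt–Trudgian 2016, Theorem 1.1: the certified computation for `N ∈ {10, …, 18, 20, 21, 28}`

Barrier catalogue `Literature/Barriers/RiemannHypothesis/`, sibling of `TuranPartialSumsAssembly.lean`.
This file DISCHARGES the named fact `PlattTrudgian2016_noZeros_sigma_ge_one` ("we ran this
algorithm for those `N` in (1.1) and in every case confirmed that `ζ_N(s)` has no zeroes for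
`σ ≥ 1`", Platt–Trudgian 2016, §2.3 — a rigorous interval-arithmetic box search in the source) by a
*certified computation inside Lean*:

* `BoxCert.claim_of_checkCells` — the cells of the initial grid cover the fundamental domain
  `σ ∈ [1, 2]`, `θ₂ ∈ [0, π]`, `θ₃, θ₅ ∈ [0, 2π]`, so `checkCells N 0 (numCells N) = true → Claim N`
  (`10 ≤ N ≤ 28`; the checker `TuranPartialSumsBoxCert.lean`, its soundness
  `TuranPartialSumsBoxCertSound.lean`, the torus reduction `TuranPartialSumsBoxData.lean`);
* `BoxCert.checkCells_10`, …, `BoxCert.checkCells_28` — one compiled evaluation (`native_decide`)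
  per `N`: `76 244` boxes in all (`N = 28`: `55 604`), about half a minute; the only non-standard axiom is the
  auxiliary axiom of `native_decide` (trust in the Lean compiler, `Lean.ofReduceBool` /
  `Lean.trustCompiler`), declared to the gate as `computational`, as for
  `DeBrangesPositivityCert.lean` and `MertensCertificate/Chunk*.lean`;
* `PlattTrudgian2016_noZeros_sigma_ge_one_holds` — the discharge, and with it Theorem 1.1 from
  Monach's theorem alone (`PlattTrudgian2016_thm11_of_monach`, through
  `PlattTrudgian2016_thm11_of_two` of `TuranPartialSumsSpiraCertificates.lean`, where the zeros for
  `N = 19, 22–27, 29, 30` are certified) and the equivalence of Theorem 1.1 with the catalogued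
  barrier `TuranPartialSums` (`PlattTrudgian2016_thm11_iff_TuranPartialSums`).

The parameters of the run (scale `2^28`, `2^14` binary angles, initial grid `8 × 4 × 4 (× 4)`,
fuel `48`) and the predicted verdicts/box counts per cell are those of the exact-integer mirror
`job/mirror2.py` in the literature-prover's folder (a counting variant of `BoxCert.search`, run in
scratch, reproduces its counts exactly: `N = 17: 2310`, `N = 20: 3504`, `N = 28: 55604`).

## References

* [PlattTrudgian2016] D. J. Platt, T. S. Trudgian, *Zeroes of partial sums of the zeta-function*,
  LMS J. Comput. Math. 19 (2016), 37–41, §2.2–§2.3 and (1.1).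
-/

open Complex

namespace Literature.Barriers.RiemannHypothesis

namespace BoxCert

/-! ## The cells cover the fundamental domain -/

/-- A point of `[0, K]` lies in one of the `K` unit cells. [folklore] -/
theorem exists_cell {x : ℝ} {K : ℕ} (hK : 0 < K) (h0 : 0 ≤ x) (h1 : x ≤ K) :
    ∃ j : ℕ, j < K ∧ (j : ℝ) ≤ x ∧ x ≤ j + 1 := by
  rcases lt_or_eq_of_le h1 with hlt | heq
  · refine ⟨⌊x⌋₊, ?_, Nat.floor_le h0, (Nat.lt_floor_add_one x).le⟩
    have := Nat.floor_le h0
    have : (⌊x⌋₊ : ℝ) < K := this.trans_lt hlt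
    exact_mod_cast this
  · refine ⟨K - 1, by omega, ?_, ?_⟩
    · rw [heq]; exact_mod_cast Nat.sub_le K 1
    · rw [heq]
      have : ((K - 1 : ℕ) : ℝ) = K - 1 := by
        rw [Nat.cast_sub (by omega)]; simp
      rw [this]; linarith

/-- The `σ`-cell of a point of `[1, 2]`. [folklore] -/
theorem exists_sigma_cell {σ : ℝ} (h1 : 1 ≤ σ) (h2 : σ ≤ 2) :
    ∃ js : ℕ, js < 8 ∧ sigLo 3 js ≤ σ ∧ σ ≤ sigHi 3 js := by
  obtain ⟨j, hj, hl, hu⟩ := exists_cell (x := 8 * (σ - 1)) (K := 8) (by norm_num) (by linarith)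
    (by push_cast; linarith)
  refine ⟨j, hj, ?_, ?_⟩
  · rw [sigLo]; norm_num; linarith
  · rw [sigHi]; norm_num; linarith

/-- The angular cell of a point of `[0, 2π · K/2^L]` at level `L`. [folklore] -/
theorem exists_angle_cell {θ : ℝ} {K L : ℕ} (hK : 0 < K) (h0 : 0 ≤ θ)
    (h1 : θ ≤ 2 * Real.pi * K / 2 ^ L) :
    ∃ a : ℕ, a < K ∧ 2 * Real.pi * a / 2 ^ L ≤ θ ∧ θ ≤ 2 * Real.pi * (a + 1) / 2 ^ L := by
  have hπ : 0 < 2 * Real.pi / 2 ^ L := by positivity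
  have h1' : θ / (2 * Real.pi / 2 ^ L) ≤ K := by
    rw [div_le_iff₀ hπ]
    calc θ ≤ 2 * Real.pi * K / 2 ^ L := h1
      _ = K * (2 * Real.pi / 2 ^ L) := by ring
  obtain ⟨a, ha, hl, hu⟩ := exists_cell (x := θ / (2 * Real.pi / 2 ^ L)) (K := K) hK
    (div_nonneg h0 hπ.le) h1'
  refine ⟨a, ha, ?_, ?_⟩
  · rw [le_div_iff₀ hπ] at hl
    calc 2 * Real.pi * a / 2 ^ L = a * (2 * Real.pi / 2 ^ L) := by ring
      _ ≤ θ := hl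
  · rw [div_le_iff₀ hπ] at hu
    calc θ ≤ (a + 1) * (2 * Real.pi / 2 ^ L) := hu
      _ = 2 * Real.pi * (a + 1) / 2 ^ L := by ring

/-- Decoding the encoded cell index. [folklore] -/
theorem decodeCell_encode (N : ℕ) {js a2 a3 a5 : ℕ} (h2 : a2 < 4) (h3 : a3 < 4) (h5 : a5 < n5 N) :
    decodeCell N (((js * 4 + a2) * 4 + a3) * n5 N + a5) = (js, a2, a3, a5) := by
  have hn : 0 < n5 N := by rw [n5]; split_ifs <;> norm_num [L05]
  have e1 : (((js * 4 + a2) * 4 + a3) * n5 N + a5) / n5 N = (js * 4 + a2) * 4 + a3 := by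
    rw [Nat.add_comm, Nat.add_mul_div_right _ _ hn, Nat.div_eq_of_lt h5, Nat.zero_add]
  have e2 : (((js * 4 + a2) * 4 + a3) * n5 N + a5) % n5 N = a5 := by
    rw [Nat.add_comm, Nat.add_mul_mod_self_right, Nat.mod_eq_of_lt h5]
  simp only [decodeCell, L02, L03, e1, e2]
  refine Prod.ext ?_ (Prod.ext ?_ (Prod.ext ?_ rfl)) <;> simp <;> omega

/-- The encoded index is a cell index. [folklore] -/
theorem encode_lt_numCells (N : ℕ) {js a2 a3 a5 : ℕ} (hjs : js < 8) (h2 : a2 < 4) (h3 : a3 < 4)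
    (h5 : a5 < n5 N) : ((js * 4 + a2) * 4 + a3) * n5 N + a5 < numCells N := by
  have : (js * 4 + a2) * 4 + a3 + 1 ≤ 128 := by omega
  calc ((js * 4 + a2) * 4 + a3) * n5 N + a5 < ((js * 4 + a2) * 4 + a3) * n5 N + n5 N := by omega
    _ = ((js * 4 + a2) * 4 + a3 + 1) * n5 N := by ring
    _ ≤ 128 * n5 N := Nat.mul_le_mul_right _ this
    _ = numCells N := by simp [numCells, ls0, L02, L03]; ring

/-- **A checked cell satisfies the claim on the cell.** [cite: PlattTrudgian2016, §2.2] -/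
theorem checkCell_sound {c : Ctx} (hc : c.Valid) {N : ℕ} (hN1 : 1 ≤ N) (hN : N ≤ 28)
    {js a2 a3 a5 : ℕ} (hjs : js < 8) (h2 : a2 < 4) (h3 : a3 < 4) (h5 : a5 < n5 N)
    (h : checkCell c N (((js * 4 + a2) * 4 + a3) * n5 N + a5) = true)
    {σ θ₂ θ₃ θ₅ : ℝ} (hσ1 : sigLo 3 js ≤ σ) (hσ2 : σ ≤ sigHi 3 js)
    (h2l : 2 * Real.pi * a2 / 2 ^ 3 ≤ θ₂) (h2u : θ₂ ≤ 2 * Real.pi * (a2 + 1) / 2 ^ 3)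
    (h3l : 2 * Real.pi * a3 / 2 ^ 2 ≤ θ₃) (h3u : θ₃ ≤ 2 * Real.pi * (a3 + 1) / 2 ^ 2)
    (h5l : 2 * Real.pi * a5 / 2 ^ (if core5 N then L05 else 0) ≤ θ₅)
    (h5u : θ₅ ≤ 2 * Real.pi * (a5 + 1) / 2 ^ (if core5 N then L05 else 0)) :
    R N σ (zOf 2 σ θ₂) (zOf 3 σ θ₃) (zOf 5 σ θ₅) <
      ‖G N 1 (zOf 2 σ θ₂) (zOf 3 σ θ₃) (zOf 5 σ θ₅)‖ := by
  rw [checkCell, decodeCell_encode N h2 h3 h5] at h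
  simp only [FUEL, ls0, L02, L03] at h
  have hL5 : (if core5 N then L05 else 0) ≤ 13 := by split_ifs <;> norm_num [L05]
  exact search_sound hc hN1 hN (core5 N) 48 (magCell_valid hjs) (by norm_num) (by norm_num) hL5 h
    hσ1 hσ2 h2l h2u h3l h3u h5l h5u

/-- **The chunk check proves the claim**: `checkCells N 0 (numCells N) = true → Claim N`
(`1 ≤ N ≤ 28`): every point of the fundamental domain lies in a cell of the initial grid.
[cite: PlattTrudgian2016, §2.2–§2.3] -/
theorem claim_of_checkCells {N : ℕ} (hN1 : 1 ≤ N) (hN : N ≤ 28)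
    (h : checkCells N 0 (numCells N) = true) : Claim N := by
  unfold checkCells at h
  split at h
  · exact absurd h Bool.false_ne_true
  · rename_i c hmk
    have hc := mkCtx_valid hmk
    rw [List.all_eq_true] at h
    intro σ θ₂ θ₃ θ₅ hσ1 hσ2 h20 h2π h30 h3π h50 h5π
    obtain ⟨js, hjs, hs1, hs2⟩ := exists_sigma_cell hσ1 hσ2
    obtain ⟨a2, ha2, h2l, h2u⟩ := exists_angle_cell (K := 4) (L := 3) (by norm_num) h20
      (h2π.trans (le_of_eq (by norm_num; ring)))
    obtain ⟨a3, ha3, h3l, h3u⟩ := exists_angle_cell (K := 4) (L := 2) (by norm_num) h30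
      (h3π.trans (le_of_eq (by norm_num)))
    obtain ⟨a5, ha5, h5l, h5u⟩ := exists_angle_cell (K := n5 N) (L := if core5 N then L05 else 0)
      (by rw [n5]; split_ifs <;> norm_num [L05]) h50
      (by rw [n5]; split_ifs <;> norm_num [L05] <;> linarith)
    have hidx := encode_lt_numCells N hjs ha2 ha3 ha5
    have hcell := h (((js * 4 + a2) * 4 + a3) * n5 N + a5) (by rw [List.mem_range'_1]; omega)
    exact checkCell_sound hc hN1 hN hjs ha2 ha3 ha5 hcell hs1 hs2 h2l h2u h3l h3u h5l h5u

/-! ## The compiled evaluations -/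

/-- `N = 10`: `checkCells 10 0 128 = true` (`998` boxes). [cite: PlattTrudgian2016, §2.3] -/
theorem checkCells_10 : checkCells 10 0 (numCells 10) = true := by native_decide

/-- `N = 11` (`1216` boxes). [cite: PlattTrudgian2016, §2.3] -/
theorem checkCells_11 : checkCells 11 0 (numCells 11) = true := by native_decide

/-- `N = 12` (`1218` boxes). [cite: PlattTrudgian2016, §2.3] -/
theorem checkCells_12 : checkCells 12 0 (numCells 12) = true := by native_decide

/-- `N = 13` (`1770` boxes). [cite: PlattTrudgian2016, §2.3] -/
theorem checkCells_13 : checkCells 13 0 (numCells 13) = true := by native_decide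

/-- `N = 14` (`1780` boxes). [cite: PlattTrudgian2016, §2.3] -/
theorem checkCells_14 : checkCells 14 0 (numCells 14) = true := by native_decide

/-- `N = 15` (`1548` boxes). [cite: PlattTrudgian2016, §2.3] -/
theorem checkCells_15 : checkCells 15 0 (numCells 15) = true := by native_decide

/-- `N = 16` (`1480` boxes). [cite: PlattTrudgian2016, §2.3] -/
theorem checkCells_16 : checkCells 16 0 (numCells 16) = true := by native_decide

/-- `N = 17` (`2310` boxes). [cite: PlattTrudgian2016, §2.3] -/
theorem checkCells_17 : checkCells 17 0 (numCells 17) = true := by native_decide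

/-- `N = 18` (`1978` boxes). [cite: PlattTrudgian2016, §2.3] -/
theorem checkCells_18 : checkCells 18 0 (numCells 18) = true := by native_decide

/-- `N = 20` (`3504` boxes). [cite: PlattTrudgian2016, §2.3] -/
theorem checkCells_20 : checkCells 20 0 (numCells 20) = true := by native_decide

/-- `N = 21` (`2838` boxes). [cite: PlattTrudgian2016, §2.3] -/
theorem checkCells_21 : checkCells 21 0 (numCells 21) = true := by native_decide

/-- `N = 28` (`55604` boxes, `5` a core prime). [cite: PlattTrudgian2016, §2.3] -/
theorem checkCells_28 : checkCells 28 0 (numCells 28) = true := by native_decide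

/-- **The claim for the twelve `N` of (1.1).** [cite: PlattTrudgian2016, §2.3 and (1.1)] -/
theorem claim_all {N : ℕ} (hN : (10 ≤ N ∧ N ≤ 18) ∨ N = 20 ∨ N = 21 ∨ N = 28) : Claim N := by
  have hN1 : 1 ≤ N := by omega
  have hN28 : N ≤ 28 := by omega
  rcases hN with ⟨h10, h18⟩ | rfl | rfl | rfl
  · interval_cases N
    · exact claim_of_checkCells hN1 hN28 checkCells_10
    · exact claim_of_checkCells hN1 hN28 checkCells_11
    · exact claim_of_checkCells hN1 hN28 checkCells_12
    · exact claim_of_checkCells hN1 hN28 checkCells_13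
    · exact claim_of_checkCells hN1 hN28 checkCells_14
    · exact claim_of_checkCells hN1 hN28 checkCells_15
    · exact claim_of_checkCells hN1 hN28 checkCells_16
    · exact claim_of_checkCells hN1 hN28 checkCells_17
    · exact claim_of_checkCells hN1 hN28 checkCells_18
  · exact claim_of_checkCells hN1 hN28 checkCells_20
  · exact claim_of_checkCells hN1 hN28 checkCells_21
  · exact claim_of_checkCells hN1 hN28 checkCells_28

end BoxCert

/-! ## The discharge -/

/-- **Platt–Trudgian 2016, §2.3 with (1.1), certified**: for `N ∈ {10, …, 18, 20, 21, 28}` the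
section `ζ_N` has no zero with `Re s ≥ 1` — the named fact
`PlattTrudgian2016_noZeros_sigma_ge_one` DISCHARGED by the box certificate (`BoxCert.claim_all`)
and the torus reduction `BoxCert.zetaPartialSum_ne_zero_of_claim`.
[cite: PlattTrudgian2016, §2.3 and (1.1)] -/
theorem PlattTrudgian2016_noZeros_sigma_ge_one_holds : PlattTrudgian2016_noZeros_sigma_ge_one :=
  fun _N hN _s hs ↦
    BoxCert.zetaPartialSum_ne_zero_of_claim (by omega) (by omega) (BoxCert.claim_all hN) hs

/-- **Theorem 1.1 from Monach's theorem alone**: with the exclusions for the twenty-one exceptional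
`N` now all proved (`Spira1968_noZeros_le_nine_holds`, `PlattTrudgian2016_noZeros_sigma_ge_one_holds`)
and the zeros for `N = 19, 22–27, 29, 30` certified (`TuranPartialSumsSpiraCertificates.lean`), the
only remaining input of Platt–Trudgian's Theorem 1.1 is Monach's theorem (a zero with `σ > 1` for
every `N > 30`, Monach 1980 as reported in Platt–Trudgian 2016, §1; the explicit hypothesis `hM`,
stated as printed). [cite: PlattTrudgian2016, §1 and Theorem 1.1] -/
theorem PlattTrudgian2016_thm11_of_monach
    (hM : ∀ N : ℕ, 30 < N → ∃ s : ℂ, 1 < s.re ∧ zetaPartialSum N s = 0) :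
    PlattTrudgian2016_thm11 :=
  PlattTrudgian2016_thm11_of_two PlattTrudgian2016_noZeros_sigma_ge_one_holds hM

/-- **Theorem 1.1 of Platt–Trudgian is equivalent to the catalogued barrier `TuranPartialSums`**
(`ζ_N` has a zero with `σ > 1` for every `N ≥ 29`): the forward direction is
`TuranPartialSums_of_PlattTrudgian`; conversely the barrier supplies Monach's statement for `N > 30`
(`exists_zero_gt_thirty_of_TuranPartialSums`) and everything else is now proved.
[cite: PlattTrudgian2016, §1 and Theorem 1.1] -/
theorem PlattTrudgian2016_thm11_iff_TuranPartialSums : PlattTrudgian2016_thm11 ↔ TuranPartialSums :=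
  ⟨TuranPartialSums_of_PlattTrudgian, fun h ↦
    PlattTrudgian2016_thm11_of_monach (exists_zero_gt_thirty_of_TuranPartialSums h)⟩

end Literature.Barriers.RiemannHypothesis
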